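import Summits.ABC.IUTFork.Conditional.AbcOfSHwBadMDeepOfLinUniformTable
import Summits.ABC.IUTFork.Conditional.AbcOfSGenuineMTameRobustRows1
import HarnessLib

/-!
# M line — the TAME-refuted rows are (almost all) M-DEEP too: a PLACE-FORM local type `e(w | p) < p^B·(p−1)` feeds abc-iut-w5-d107's
# uniform depth bound, so the Tate-exact rows (`e ∣ 10·l`, `∣ 6·l`, hence `B = 0` over `p ≥ 10·l + 2`, `6·l + 2`) WITNESS the depth antecedent
# of the M window binder exactly like the [LIN] rows — kernel form of this seat's routing signal on the M window family (HOME/STATUS 23:5xZ)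

PROOF-ONLY file (no `def`, no new `Prop`, no instance) of the abc-iut cell (seat abc-iut-W-ref-1, gen 3; row «W:M-TE-ROBUST», sequel of this seat's
`AbcOfSGenuineMTameRobustRows1` p474314). TAKES NO SIDE on [IUTchIII] Cor. 3.12 or on any author. NOTHING NEW IS COMPUTED: §1 is abc-iut-C-cert-3's
`GenuineM.exists_deep_ratPoint_of_linUniform` (p470379 — abc-iut-w5-d107's depth witness `hdeep` exported) with its local-type step
(`e ∣ 30·l`, `30·l < p^B·(p−1)`) replaced by the PLACE-FORM input «every place `w` of `T.K` over `p_u` has `p_u ∤ e(w|p_u)` and `e(w|p_u) < p_u^B·(p_u−1)`»,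
which is all that abc-iut-w5-d107's `depthConstants_le_of_not_dvd_of_lt_pow` (`d + a + b ≤ B + 1 + 1/(p−2) − 1/e`) consumes; §2 discharges that input by
abc-iut-W-ref-2's / abc-iut-w4-d087's Tate-exact local type (`Cor22.ThetaVolumeDatumAt.ramificationIdx_int_dvd_ten_mul_ratPoint'` / `…_six_mul_ratPoint'`:
`3 ∣ v_p(abc)` ⇒ `e ∣ 10·l`, `5 ∣ v_p(abc)` ⇒ `e ∣ 6·l`), so that `B = 0` is available as soon as `10·l < p − 1` (resp. `6·l < p − 1`) — where the `∣ 30·l` form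
of p470379 would need `B = 1` and its test fails; §3 instantiates at the rows of `AbcOfSGenuineMTameRobustRows1`.
* `GenuineM.exists_deep_ratPoint_of_localTypeLin` — `λ ∈ ℚ`, `T` at `(ratPoint λ, l)`, `u` with `p_u ≠ 2, l`, the place-form local input with exponent `B`,
  a pole of `j(λ)` of order `≥ h` at `p_u`, a label `i₀ + 1 ≤ l⋆` with abc-iut-w5-d107's integer test `2l·((i₀+2)·((B+1)(p−2)+1) + (p−2)) ≤ h·i₀(i₀+2)·(p−2)`
  ⟹ THERE IS an M-deep `(u, i₀, x₀)` — the `∃`-clause whose NEGATION is the depth antecedent of the M window binders (p445989 / p453767 / p461893), VERBATIM as in p470379;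
* `GenuineM.exists_deep_triple_of_ten` / `…_of_six` — abc-triple forms: `p_u ∉ {2,3,5,l}`, `p_u^v ∥ abc` with `3 ∣ v` (resp. `5 ∣ v`), `10·l < p_u^B·(p_u−1)`
  (resp. `6·l < …`), the test with `h = 2v`;
* §3 rows (`B = 0`, top label or below): `…_frey6718464_p179_tame` (l = 13: `26·1423 = 36998 ≤ 37170`), `…_frey9765625_p199_tame` (l = 17, 19 — NOT l = 11:
  `30470 > 28368` at every label), `…_frey99794037551104_p97_tame` (l = 7, 11, 13), `…_frey99794037551104_p223_tame` (l = 13, 17, 19 — at l = 11 the test fails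
  over 223 but holds over 97), and the te30 rows `…_frey1025227_p4229_tame` (l = 53, 61, 73, 89, 103; `e ∣ 30·l`, `B = 0` since `30·l < 4228`: p470379's own
  triple form `GenuineM.exists_deep_triple_of_linUniform`, p472279).
CONSEQUENCE FOR THE BOOKS (C-SCOREBOARD §3c «hSHwBad_M … route = a tame-exact M row»): of the 16 (datum, l, p) instances refuted at the M setting by
`AbcOfSGenuineMTameRobustRows1`, 15 (datum, l) are M-DEEP by the theorems below, so abc-iut-C-cert-3's socket `not_hSHwBad_M_of_refuted` (p468391 §1, input
«every genuine datum is M-shallow») CANNOT fire there either; the ONLY tame-refuted (datum, l) not certified M-deep here is `2·3·11·13⁴ + 199³ = 5¹⁰` at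
`l = 11` (over 199 the test fails at every label; its depth at the other places — 2, 3, 5, 11, 13 — is not examined). M-shallowness of that datum is NOT
claimed. HONEST FRAMING: a depth witness concerns OUR sharp M setting and says nothing about print; admissibility / Szpiro-badness / (P6) / non-emptiness NOT
claimed; typed ≠ proved; instantiated ≠ endorsed; no abc claim. [cite: Mochizuki2012, IUTchIII Cor. 3.12 Step (xi-f) p. 184; IUTchIV Prop. 1.2 (i)(ii) p. 10,
Thm. 1.10 proof Steps (ii)–(iii) p. 24–26, Cor. 2.2 (ii) proof p. 44–46] [cite: Serre1972, §1.11–§1.12] [cite: SerreLocalFields1979, Ch. III §6 Prop. 13]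
[cite: MochizukiGenEll2010, Thm. 2.1 p. 11] [claim: Mochizuki2012, status: disputed] for every IUT sentence quoted.
-/

noncomputable section

open Set Function NumberField IsDedekindDomain

namespace Summit.ABC.IUTFork.Conditional

open Thm311 Thm311.Real Cor312 Cor312Vol Cor312Prov Literature.IUT.LogThetaLattice Literature.IUT.LogVolume
  Literature.IUT.HodgeTheaters Literature.IUT.LogVolume.ThetaData Literature.IUT.LogVolume.Cor22
open Literature.NumberTheory.NumberFields Literature.NumberTheory.GaloisRepresentations.Ultrametric
open Literature.NumberTheory.DiophantineGeometry Literature.NumberTheory.DiophantineGeometry.GenEll Summit.ABC.ABC.Theorems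

/-! ## §1. Place-form local type ⟹ a depth witness (abc-iut-w5-d107's `hdeep`, p470379's export, local step generalised) -/

/-- **M-DEEP from a PLACE-FORM local type.** `λ ∈ ℚ`, `T` a genuine Θ-volume datum at `(ratPoint λ, l)`, `u` a finite place of `ℚ` with `p = p_u ≠ 2, l`
at which `j(λ)` has a pole of order `≥ h ≥ 1`; an exponent `B` such that every place `w` of `T.K` over `p` has `p ∤ e(w|p)` and `e(w|p) < p^B·(p−1)`; a label
`j = i₀+1 ≤ l⋆` with `2l·((i₀+2)·((B+1)(p−2)+1) + (p−2)) ≤ h·i₀(i₀+2)·(p−2)`. THEN some `(u, i₀, x₀)` is M-deep: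
`p^{((i₀+2)·(d+a+b)+1)} · ‖t_{q,x₀}‖^{(i₀+1)²−1} < 1` at the member's field `kOfM` (`depthConstants_le_of_not_dvd_of_lt_pow` + `placeModOfM_mem_S_and_norm_tqM_le_of_ratPoint`;
the member's `e` IS `e(placeOfM x₀ | p)`, `absRamificationIdx_rescaledCompletion`). Nothing asserted about print.
[cite: Mochizuki2012, IUTchIV Prop. 1.2 (i)(ii) p. 10, Cor. 2.2 (ii) proof (P5) p. 46] [cite: SerreLocalFields1979, Ch. III §6 Prop. 13] [claim: Mochizuki2012, status: disputed] -/
theorem GenuineM.exists_deep_ratPoint_of_localTypeLin {q : ℚ} {l : ℕ}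
    (T : Cor22.ThetaVolumeDatumAt (ratPoint q) l) (u : FinitePlace ℚ) (hp2 : ratChar u ≠ 2) (hpl : ratChar u ≠ l) (B : ℕ)
    (hloc : letI := T.instFieldK; letI := T.instNumberFieldK
      ∀ w : HeightOneSpectrum (𝓞 T.K), residueChar T.K w = ratChar u →
        ¬ ratChar u ∣ w.asIdeal.ramificationIdx ℤ ∧ w.asIdeal.ramificationIdx ℤ < ratChar u ^ B * (ratChar u - 1))
    (h : ℕ) (hh : 1 ≤ h)
    (hord : ∀ u' : HeightOneSpectrum (𝓞 ℚ), Rat.HeightOneSpectrum.natGenerator u' = ratChar u → ord ℚ u' (Cor22.jInv q) ≤ -(h : ℤ))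
    (i₀ : ℕ) (hil : i₀ + 1 ≤ (l - 1) / 2)
    (htest : 2 * l * ((i₀ + 2) * ((B + 1) * (ratChar u - 2) + 1) + (ratChar u - 2)) ≤ h * (i₀ * (i₀ + 2)) * (ratChar u - 2)) :
    letI := T.instFieldF; letI := T.instNumberFieldF; letI := T.instAlgebraF; letI := T.instFieldK
    letI := T.instNumberFieldK; letI := T.instAlgebraK; letI := T.instFieldFbar; letI := T.instAlgebraFbar
    letI := T.instAlgebraKFbar; letI := T.instIsElliptic
    ∃ (u : FinitePlace ℚ) (i : Fin (thetaIndexOfInitial T.D).lstar) (x₀ : (thetaIndexOfInitial T.D).Fibre (Val.non u)),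
        ((ratChar u : ℕ) : ℝ) ^ ((((i : ℕ) : ℝ) + 2) *
        (differentOrd (ratChar u) (kOfM T.D (ratChar u) u (natCast_ratChar_mem u) x₀)
        + logRadiusA (ratChar u) (absRamificationIdx (ratChar u) (kOfM T.D (ratChar u) u (natCast_ratChar_mem u) x₀))
        + logRadiusB (ratChar u) (absRamificationIdx (ratChar u) (kOfM T.D (ratChar u) u (natCast_ratChar_mem u) x₀))) + 1) *
        ‖tqM T.D (ratChar u) u (natCast_ratChar_mem u) (ideleDataOf T.D T.isVolumeInputOf) x₀‖ ^ (((i : ℕ) + 1) ^ 2 - 1) < 1 := by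
  classical
  letI := T.instFieldF; letI := T.instNumberFieldF; letI := T.instAlgebraF; letI := T.instFieldK
  letI := T.instNumberFieldK; letI := T.instAlgebraK; letI := T.instFieldFbar; letI := T.instAlgebraFbar
  letI := T.instAlgebraKFbar; letI := T.instIsElliptic
  set p : ℕ := ratChar u with hpdef
  haveI hpfact : Fact p.Prime := inferInstance
  obtain ⟨v, hv⟩ := (thetaIndexOfInitial T.D).fibre_nonempty (Val.non u)
  set x₀ : (thetaIndexOfInitial T.D).Fibre (Val.non u) := ⟨v, hv⟩ with hx₀def
  -- the label
  have hlstar : (thetaIndexOfInitial T.D).lstar = (l - 1) / 2 := rfl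
  have hlt : i₀ < (thetaIndexOfInitial T.D).lstar := by rw [hlstar]; omega
  have hl5 : 5 ≤ l := T.D.five_le_l
  obtain ⟨p', hp'⟩ : ∃ p', p = p' + 3 := ⟨p - 3, by have := hpfact.out.two_le; omega⟩
  have hp2' : 2 < p := by omega
  have hp0 : (0 : ℝ) < (p : ℝ) := by exact_mod_cast hpfact.out.pos
  have hp1 : (1 : ℝ) < (p : ℝ) := by exact_mod_cast hpfact.out.one_lt
  -- `‖t_q(x₀)‖ ≤ p^{−h/(2l)}` at the member (every member is bad)
  obtain ⟨-, hnorm⟩ := placeModOfM_mem_S_and_norm_tqM_le_of_ratPoint T.D p u (natCast_ratChar_mem u)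
    (ideleDataOf T.D T.isVolumeInputOf) q T.j_eq T.isP5Choice x₀ hp2 hpl h hh hord
  -- the place-form local type at the `K`-place under the member
  set w := placeOfM T.D u x₀ with hwdef
  have hpw : ((p : ℕ) : 𝓞 T.K) ∈ w.asIdeal := natCast_mem_placeOfM T.D p u (natCast_ratChar_mem u) x₀
  have hwchar : residueChar T.K w = p := residueChar_eq_of_natCast_mem p hpw
  set e : ℕ := absRamificationIdx p (kOfM T.D p u (natCast_ratChar_mem u) x₀) with hedef
  have heK : e = w.asIdeal.ramificationIdx ℤ := absRamificationIdx_rescaledCompletion T.K p w hpw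
  have hndvd : ¬ p ∣ e := by rw [heK]; exact (hloc w hwchar).1
  have he0 : 0 < e := absRamificationIdx_pos p _
  have hel : e < p ^ B * (p - 1) := by rw [heK]; exact (hloc w hwchar).2
  have hdab := depthConstants_le_of_not_dvd_of_lt_pow p (kOfM T.D p u (natCast_ratChar_mem u) x₀) hp2' hndvd hel
  set dab : ℝ := differentOrd p (kOfM T.D p u (natCast_ratChar_mem u) x₀) + logRadiusA p e + logRadiusB p e with hdabdef
  have he' : (0 : ℝ) < (e : ℝ) := by exact_mod_cast he0
  have h1e : 0 < 1 / (e : ℝ) := by positivity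
  have hi0 : (0 : ℝ) < (i₀ : ℝ) + 2 := by positivity
  -- the integer test over `ℝ`
  have htestR : ((i₀ : ℝ) + 2) * ((B : ℝ) + 1 + 1 / ((p : ℝ) - 2)) + 1 ≤ (h : ℝ) / (2 * l) * ((i₀ : ℝ) * ((i₀ : ℝ) + 2)) := by
    have hc : ((p : ℝ) - 2) = (p' : ℝ) + 1 := by rw [hp']; push_cast; ring
    have key : (2 * (l : ℝ)) * (((i₀ : ℝ) + 2) * (((B : ℝ) + 1) * ((p' : ℝ) + 1) + 1) + ((p' : ℝ) + 1)) ≤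
        (h : ℝ) * ((i₀ : ℝ) * ((i₀ : ℝ) + 2)) * ((p' : ℝ) + 1) := by
      have h1 : p - 2 = p' + 1 := by omega
      rw [h1] at htest
      exact_mod_cast htest
    rw [hc]
    rw [show ((i₀ : ℝ) + 2) * ((B : ℝ) + 1 + 1 / ((p' : ℝ) + 1)) + 1 =
        ((2 * (l : ℝ)) * (((i₀ : ℝ) + 2) * (((B : ℝ) + 1) * ((p' : ℝ) + 1) + 1) + ((p' : ℝ) + 1))) /
          ((2 * (l : ℝ)) * ((p' : ℝ) + 1)) by field_simp]
    rw [show (h : ℝ) / (2 * l) * ((i₀ : ℝ) * ((i₀ : ℝ) + 2)) =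
        ((h : ℝ) * ((i₀ : ℝ) * ((i₀ : ℝ) + 2)) * ((p' : ℝ) + 1)) / ((2 * (l : ℝ)) * ((p' : ℝ) + 1)) by field_simp]
    exact div_le_div_of_nonneg_right key (by positivity)
  have hA : ((i₀ : ℝ) + 2) * dab + 1 < (h : ℝ) / (2 * l) * ((i₀ : ℝ) * ((i₀ : ℝ) + 2)) := by
    have h1 : ((i₀ : ℝ) + 2) * dab ≤ ((i₀ : ℝ) + 2) * ((B : ℝ) + 1 + 1 / ((p : ℝ) - 2) - 1 / (e : ℝ)) :=
      mul_le_mul_of_nonneg_left hdab hi0.le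
    nlinarith [mul_pos hi0 h1e]
  -- assemble `hdeep`
  set τ : ℝ := ‖tqM T.D p u (natCast_ratChar_mem u) (ideleDataOf T.D T.isVolumeInputOf) x₀‖ with hτdef
  have hτ0 : 0 ≤ τ := norm_nonneg _
  have hn : (i₀ + 1) ^ 2 - 1 = i₀ * (i₀ + 2) := by
    have : (i₀ + 1) ^ 2 = i₀ * (i₀ + 2) + 1 := by ring
    omega
  have hpow : τ ^ ((i₀ + 1) ^ 2 - 1) ≤ (p : ℝ) ^ ((-(h : ℝ) / (2 * l)) * ((i₀ : ℝ) * ((i₀ : ℝ) + 2))) := by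
    rw [hn]
    calc τ ^ (i₀ * (i₀ + 2)) ≤ ((p : ℝ) ^ (-(h : ℝ) / (2 * l))) ^ (i₀ * (i₀ + 2)) := pow_le_pow_left₀ hτ0 hnorm _
      _ = (p : ℝ) ^ ((-(h : ℝ) / (2 * l)) * ((i₀ : ℝ) * ((i₀ : ℝ) + 2))) := by
          rw [← Real.rpow_natCast, ← Real.rpow_mul hp0.le]
          push_cast
          ring_nf
  have hdeep : (p : ℝ) ^ ((((i₀ : ℕ) : ℝ) + 2) * dab + 1) * τ ^ (((i₀ : ℕ) + 1) ^ 2 - 1) < 1 := by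
    have hApos : 0 < (p : ℝ) ^ ((((i₀ : ℕ) : ℝ) + 2) * dab + 1) := Real.rpow_pos_of_pos hp0 _
    calc (p : ℝ) ^ ((((i₀ : ℕ) : ℝ) + 2) * dab + 1) * τ ^ (((i₀ : ℕ) + 1) ^ 2 - 1)
        ≤ (p : ℝ) ^ ((((i₀ : ℕ) : ℝ) + 2) * dab + 1) * (p : ℝ) ^ ((-(h : ℝ) / (2 * l)) * ((i₀ : ℝ) * ((i₀ : ℝ) + 2))) :=
          mul_le_mul_of_nonneg_left hpow hApos.le
      _ = (p : ℝ) ^ ((((i₀ : ℕ) : ℝ) + 2) * dab + 1 + (-(h : ℝ) / (2 * l)) * ((i₀ : ℝ) * ((i₀ : ℝ) + 2))) := (Real.rpow_add hp0 _ _).symm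
      _ < (p : ℝ) ^ (0 : ℝ) := by
          apply Real.rpow_lt_rpow_of_exponent_lt hp1
          have : (-(h : ℝ) / (2 * l)) * ((i₀ : ℝ) * ((i₀ : ℝ) + 2)) = -((h : ℝ) / (2 * l) * ((i₀ : ℝ) * ((i₀ : ℝ) + 2))) := by ring
          rw [this]
          linarith
      _ = 1 := Real.rpow_zero _
  exact ⟨u, ⟨i₀, hlt⟩, x₀, hdeep⟩

/-! ## §2. abc-triple forms with the Tate-exact local type (`3 ∣ v` ⇒ `e ∣ 10·l`; `5 ∣ v` ⇒ `e ∣ 6·l`) -/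

/-- **M-DEEP, abc-TRIPLE form, Tate-exact local type `e ∣ 10·l`.** `a + b = c` coprime, `λ = a/c`, `T` a genuine Θ-volume datum at `(ratPoint (a/c), l)`,
`u` with `p = p_u ∉ {2, 3, 5, l}`, `p^v ∣ abc`, `p^{v+1} ∤ abc` with **`3 ∣ v`**, an exponent `B` with **`10·l < p^B·(p−1)`**, a label `i₀ + 1 ≤ l⋆` with the
integer test at `h = 2v`. THEN some `(u, i₀, x₀)` is M-deep: every `w | p` of `T.K` has `e(w|p) ∣ 10·l` (`Cor22.ThetaVolumeDatumAt.ramificationIdx_int_dvd_ten_mul_ratPoint'`,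
Serre 1972 n° 1.12), hence `p ∤ e`, `e < p^B·(p−1)`, and §1 applies with `ord_p j(a/c) = −2v` (`Cor22.ord_jInv_ratPoint_triple_eq`). [cite: Mochizuki2012,
IUTchIV Thm. 1.10 proof Steps (ii)–(iii) p. 24–26, Cor. 2.2 (ii) proof p. 44] [cite: Serre1972, §1.11–§1.12] [claim: Mochizuki2012, status: disputed] -/
theorem GenuineM.exists_deep_triple_of_ten {a b c : ℕ} (habc : IsABCTriple a b c) {l : ℕ}
    (T : Cor22.ThetaVolumeDatumAt (ratPoint ((a : ℚ) / c)) l) (u : FinitePlace ℚ) (hp2 : ratChar u ≠ 2) (hp3 : ratChar u ≠ 3)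
    (hp5 : ratChar u ≠ 5) (hpl : ratChar u ≠ l) (v : ℕ) (hv : 1 ≤ v) (hdvd : ratChar u ^ v ∣ a * b * c)
    (hndvd : ¬ ratChar u ^ (v + 1) ∣ a * b * c) (hqv : 3 ∣ v) (B : ℕ) (hB : 10 * l < ratChar u ^ B * (ratChar u - 1))
    (i₀ : ℕ) (hil : i₀ + 1 ≤ (l - 1) / 2)
    (htest : 2 * l * ((i₀ + 2) * ((B + 1) * (ratChar u - 2) + 1) + (ratChar u - 2)) ≤ 2 * v * (i₀ * (i₀ + 2)) * (ratChar u - 2)) :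
    letI := T.instFieldF; letI := T.instNumberFieldF; letI := T.instAlgebraF; letI := T.instFieldK
    letI := T.instNumberFieldK; letI := T.instAlgebraK; letI := T.instFieldFbar; letI := T.instAlgebraFbar
    letI := T.instAlgebraKFbar; letI := T.instIsElliptic
    ∃ (u : FinitePlace ℚ) (i : Fin (thetaIndexOfInitial T.D).lstar) (x₀ : (thetaIndexOfInitial T.D).Fibre (Val.non u)),
        ((ratChar u : ℕ) : ℝ) ^ ((((i : ℕ) : ℝ) + 2) *
        (differentOrd (ratChar u) (kOfM T.D (ratChar u) u (natCast_ratChar_mem u) x₀)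
        + logRadiusA (ratChar u) (absRamificationIdx (ratChar u) (kOfM T.D (ratChar u) u (natCast_ratChar_mem u) x₀))
        + logRadiusB (ratChar u) (absRamificationIdx (ratChar u) (kOfM T.D (ratChar u) u (natCast_ratChar_mem u) x₀))) + 1) *
        ‖tqM T.D (ratChar u) u (natCast_ratChar_mem u) (ideleDataOf T.D T.isVolumeInputOf) x₀‖ ^ (((i : ℕ) + 1) ^ 2 - 1) < 1 := by
  letI := T.instFieldF; letI := T.instNumberFieldF; letI := T.instAlgebraF; letI := T.instFieldK
  letI := T.instNumberFieldK; letI := T.instAlgebraK; letI := T.instFieldFbar; letI := T.instAlgebraFbar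
  letI := T.instAlgebraKFbar; letI := T.instIsElliptic
  have hp : (ratChar u).Prime := (inferInstance : Fact (ratChar u).Prime).out
  -- `v_p(abc) = v`
  have habc0 : a * b * c ≠ 0 := by
    obtain ⟨ha, hb, hsum, -⟩ := habc
    exact Nat.mul_ne_zero (Nat.mul_ne_zero ha.ne' hb.ne') (by omega)
  have hfac : (a * b * c).factorization (ratChar u) = v := by
    have h1 : v ≤ (a * b * c).factorization (ratChar u) := (hp.pow_dvd_iff_le_factorization habc0).1 hdvd
    have h2 : ¬ v + 1 ≤ (a * b * c).factorization (ratChar u) := fun h' =>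
      hndvd ((hp.pow_dvd_iff_le_factorization habc0).2 h')
    omega
  have hpabc : ratChar u ∣ a * b * c := (dvd_pow_self _ (by omega)).trans hdvd
  -- `ord_p j(a/c) = −2v` and `3 ∣ ord_p j(a/c)`
  have hordeq : ∀ u' : HeightOneSpectrum (𝓞 ℚ), Rat.HeightOneSpectrum.natGenerator u' = ratChar u →
      ord ℚ u' (Cor22.jInv ((a : ℚ) / c)) = -((2 * v : ℕ) : ℤ) := by
    intro u' hu'
    rw [Cor22.ord_jInv_ratPoint_triple_eq habc u' (hu' ▸ hp2) (hu' ▸ hpabc), hu', hfac]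
    push_cast
    ring
  have hord : ∀ u' : HeightOneSpectrum (𝓞 ℚ), Rat.HeightOneSpectrum.natGenerator u' = ratChar u →
      ord ℚ u' (Cor22.jInv ((a : ℚ) / c)) ≤ -((2 * v : ℕ) : ℤ) := fun u' hu' => (hordeq u' hu').le
  have hpole : ∀ u' : HeightOneSpectrum (𝓞 ℚ), Rat.HeightOneSpectrum.natGenerator u' = ratChar u →
      ord ℚ u' (Cor22.jInv ((a : ℚ) / c)) < 0 := fun u' hu' => by
    rw [hordeq u' hu']; push_cast; omega
  have hordq : ∀ u' : HeightOneSpectrum (𝓞 ℚ), Rat.HeightOneSpectrum.natGenerator u' = ratChar u →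
      (3 : ℤ) ∣ ord ℚ u' (Cor22.jInv ((a : ℚ) / c)) := fun u' hu' => by
    exact_mod_cast Cor22.natCast_dvd_ord_jInv_ratPoint_triple habc hp2 hpabc (n := 3) (by rw [hfac]; exact hqv) u' hu'
  -- the Tate-exact local type in place form: `e(w|p) ∣ 10·l`, so `p ∤ e` and `e < p^B·(p−1)`
  have hnot : ratChar u ∉ ({2, 3, 5, l} : Finset ℕ) := by
    simp only [Finset.mem_insert, Finset.mem_singleton, not_or]
    exact ⟨hp2, hp3, hp5, hpl⟩
  have hl : l.Prime := T.D.l_prime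
  have hl0 : 0 < l := by
    have := T.D.five_le_l
    omega
  have hloc : ∀ w : HeightOneSpectrum (𝓞 T.K), residueChar T.K w = ratChar u →
      ¬ ratChar u ∣ w.asIdeal.ramificationIdx ℤ ∧ w.asIdeal.ramificationIdx ℤ < ratChar u ^ B * (ratChar u - 1) := by
    intro w hw
    have hd : w.asIdeal.ramificationIdx ℤ ∣ 10 * l := T.ramificationIdx_int_dvd_ten_mul_ratPoint' hnot hpole hordq w hw
    refine ⟨LinUniformM.not_dvd_of_dvd_thirty_mul hp hl hp2 hp3 hp5 hpl (hd.trans ⟨3, by ring⟩), ?_⟩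
    exact lt_of_le_of_lt (Nat.le_of_dvd (by omega) hd) hB
  exact GenuineM.exists_deep_ratPoint_of_localTypeLin T u hp2 hpl B hloc (2 * v) (by omega) hord i₀ hil htest

/-- **M-DEEP, abc-TRIPLE form, Tate-exact local type `e ∣ 6·l`.** `a + b = c` coprime, `λ = a/c`, `T` a genuine Θ-volume datum at `(ratPoint (a/c), l)`,
`u` with `p = p_u ∉ {2, 3, 5, l}`, `p^v ∣ abc`, `p^{v+1} ∤ abc` with **`5 ∣ v`**, an exponent `B` with **`6·l < p^B·(p−1)`**, a label `i₀ + 1 ≤ l⋆` with the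
integer test at `h = 2v`. THEN some `(u, i₀, x₀)` is M-deep: every `w | p` of `T.K` has `e(w|p) ∣ 6·l` (`Cor22.ThetaVolumeDatumAt.ramificationIdx_int_dvd_six_mul_ratPoint'`,
Serre 1972 n° 1.12), hence `p ∤ e`, `e < p^B·(p−1)`, and §1 applies with `ord_p j(a/c) = −2v` (`Cor22.ord_jInv_ratPoint_triple_eq`). [cite: Mochizuki2012,
IUTchIV Thm. 1.10 proof Steps (ii)–(iii) p. 24–26, Cor. 2.2 (ii) proof p. 44] [cite: Serre1972, §1.11–§1.12] [claim: Mochizuki2012, status: disputed] -/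
theorem GenuineM.exists_deep_triple_of_six {a b c : ℕ} (habc : IsABCTriple a b c) {l : ℕ}
    (T : Cor22.ThetaVolumeDatumAt (ratPoint ((a : ℚ) / c)) l) (u : FinitePlace ℚ) (hp2 : ratChar u ≠ 2) (hp3 : ratChar u ≠ 3)
    (hp5 : ratChar u ≠ 5) (hpl : ratChar u ≠ l) (v : ℕ) (hv : 1 ≤ v) (hdvd : ratChar u ^ v ∣ a * b * c)
    (hndvd : ¬ ratChar u ^ (v + 1) ∣ a * b * c) (hqv : 5 ∣ v) (B : ℕ) (hB : 6 * l < ratChar u ^ B * (ratChar u - 1))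
    (i₀ : ℕ) (hil : i₀ + 1 ≤ (l - 1) / 2)
    (htest : 2 * l * ((i₀ + 2) * ((B + 1) * (ratChar u - 2) + 1) + (ratChar u - 2)) ≤ 2 * v * (i₀ * (i₀ + 2)) * (ratChar u - 2)) :
    letI := T.instFieldF; letI := T.instNumberFieldF; letI := T.instAlgebraF; letI := T.instFieldK
    letI := T.instNumberFieldK; letI := T.instAlgebraK; letI := T.instFieldFbar; letI := T.instAlgebraFbar
    letI := T.instAlgebraKFbar; letI := T.instIsElliptic
    ∃ (u : FinitePlace ℚ) (i : Fin (thetaIndexOfInitial T.D).lstar) (x₀ : (thetaIndexOfInitial T.D).Fibre (Val.non u)),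
        ((ratChar u : ℕ) : ℝ) ^ ((((i : ℕ) : ℝ) + 2) *
        (differentOrd (ratChar u) (kOfM T.D (ratChar u) u (natCast_ratChar_mem u) x₀)
        + logRadiusA (ratChar u) (absRamificationIdx (ratChar u) (kOfM T.D (ratChar u) u (natCast_ratChar_mem u) x₀))
        + logRadiusB (ratChar u) (absRamificationIdx (ratChar u) (kOfM T.D (ratChar u) u (natCast_ratChar_mem u) x₀))) + 1) *
        ‖tqM T.D (ratChar u) u (natCast_ratChar_mem u) (ideleDataOf T.D T.isVolumeInputOf) x₀‖ ^ (((i : ℕ) + 1) ^ 2 - 1) < 1 := by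
  letI := T.instFieldF; letI := T.instNumberFieldF; letI := T.instAlgebraF; letI := T.instFieldK
  letI := T.instNumberFieldK; letI := T.instAlgebraK; letI := T.instFieldFbar; letI := T.instAlgebraFbar
  letI := T.instAlgebraKFbar; letI := T.instIsElliptic
  have hp : (ratChar u).Prime := (inferInstance : Fact (ratChar u).Prime).out
  -- `v_p(abc) = v`
  have habc0 : a * b * c ≠ 0 := by
    obtain ⟨ha, hb, hsum, -⟩ := habc
    exact Nat.mul_ne_zero (Nat.mul_ne_zero ha.ne' hb.ne') (by omega)
  have hfac : (a * b * c).factorization (ratChar u) = v := by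
    have h1 : v ≤ (a * b * c).factorization (ratChar u) := (hp.pow_dvd_iff_le_factorization habc0).1 hdvd
    have h2 : ¬ v + 1 ≤ (a * b * c).factorization (ratChar u) := fun h' =>
      hndvd ((hp.pow_dvd_iff_le_factorization habc0).2 h')
    omega
  have hpabc : ratChar u ∣ a * b * c := (dvd_pow_self _ (by omega)).trans hdvd
  -- `ord_p j(a/c) = −2v` and `5 ∣ ord_p j(a/c)`
  have hordeq : ∀ u' : HeightOneSpectrum (𝓞 ℚ), Rat.HeightOneSpectrum.natGenerator u' = ratChar u →
      ord ℚ u' (Cor22.jInv ((a : ℚ) / c)) = -((2 * v : ℕ) : ℤ) := by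
    intro u' hu'
    rw [Cor22.ord_jInv_ratPoint_triple_eq habc u' (hu' ▸ hp2) (hu' ▸ hpabc), hu', hfac]
    push_cast
    ring
  have hord : ∀ u' : HeightOneSpectrum (𝓞 ℚ), Rat.HeightOneSpectrum.natGenerator u' = ratChar u →
      ord ℚ u' (Cor22.jInv ((a : ℚ) / c)) ≤ -((2 * v : ℕ) : ℤ) := fun u' hu' => (hordeq u' hu').le
  have hpole : ∀ u' : HeightOneSpectrum (𝓞 ℚ), Rat.HeightOneSpectrum.natGenerator u' = ratChar u →
      ord ℚ u' (Cor22.jInv ((a : ℚ) / c)) < 0 := fun u' hu' => by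
    rw [hordeq u' hu']; push_cast; omega
  have hordq : ∀ u' : HeightOneSpectrum (𝓞 ℚ), Rat.HeightOneSpectrum.natGenerator u' = ratChar u →
      (5 : ℤ) ∣ ord ℚ u' (Cor22.jInv ((a : ℚ) / c)) := fun u' hu' => by
    exact_mod_cast Cor22.natCast_dvd_ord_jInv_ratPoint_triple habc hp2 hpabc (n := 5) (by rw [hfac]; exact hqv) u' hu'
  -- the Tate-exact local type in place form: `e(w|p) ∣ 6·l`, so `p ∤ e` and `e < p^B·(p−1)`
  have hnot : ratChar u ∉ ({2, 3, 5, l} : Finset ℕ) := by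
    simp only [Finset.mem_insert, Finset.mem_singleton, not_or]
    exact ⟨hp2, hp3, hp5, hpl⟩
  have hl : l.Prime := T.D.l_prime
  have hl0 : 0 < l := by
    have := T.D.five_le_l
    omega
  have hloc : ∀ w : HeightOneSpectrum (𝓞 T.K), residueChar T.K w = ratChar u →
      ¬ ratChar u ∣ w.asIdeal.ramificationIdx ℤ ∧ w.asIdeal.ramificationIdx ℤ < ratChar u ^ B * (ratChar u - 1) := by
    intro w hw
    have hd : w.asIdeal.ramificationIdx ℤ ∣ 6 * l := T.ramificationIdx_int_dvd_six_mul_ratPoint' hnot hpole hordq w hw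
    refine ⟨LinUniformM.not_dvd_of_dvd_thirty_mul hp hl hp2 hp3 hp5 hpl (hd.trans ⟨5, by ring⟩), ?_⟩
    exact lt_of_le_of_lt (Nat.le_of_dvd (by omega) hd) hB
  exact GenuineM.exists_deep_ratPoint_of_localTypeLin T u hp2 hpl B hloc (2 * v) (by omega) hord i₀ hil htest

/-! ## §3. Rows: the data of `AbcOfSGenuineMTameRobustRows1` are M-DEEP at a witnessing place (`B = 0`), except `2·3·11·13⁴ + 199³ = 5¹⁰` at `l = 11` -/

/-- **M-DEEP row: R-W ANNEX-1 datum `5⁴·11²·13 + 179³ = 2¹⁰·3⁸`, `l = 13`, over `p = 179`** (`179³ ∥ abc`, `3 ∣ 3`, `B = 0`: `130 < 178`; top label `i₀ = 5`: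
`26·(7·178 + 177) = 36998 ≤ 6·5·7·177 = 37170`). [claim: Mochizuki2012, status: disputed] [cite: Mochizuki2012, IUTchIV Prop. 1.2 p. 10] -/
theorem GenuineM.exists_deep_frey6718464_p179_tame
    (T : Cor22.ThetaVolumeDatumAt (ratPoint (((5 ^ 4 * 11 ^ 2 * 13 : ℕ) : ℚ) / (2 ^ 10 * 3 ^ 8 : ℕ))) 13) (u : FinitePlace ℚ) (hu : ratChar u = 179) :
    letI := T.instFieldF; letI := T.instNumberFieldF; letI := T.instAlgebraF; letI := T.instFieldK
    letI := T.instNumberFieldK; letI := T.instAlgebraK; letI := T.instFieldFbar; letI := T.instAlgebraFbar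
    letI := T.instAlgebraKFbar; letI := T.instIsElliptic
    ∃ (u : FinitePlace ℚ) (i : Fin (thetaIndexOfInitial T.D).lstar) (x₀ : (thetaIndexOfInitial T.D).Fibre (Val.non u)),
        ((ratChar u : ℕ) : ℝ) ^ ((((i : ℕ) : ℝ) + 2) *
        (differentOrd (ratChar u) (kOfM T.D (ratChar u) u (natCast_ratChar_mem u) x₀)
        + logRadiusA (ratChar u) (absRamificationIdx (ratChar u) (kOfM T.D (ratChar u) u (natCast_ratChar_mem u) x₀))
        + logRadiusB (ratChar u) (absRamificationIdx (ratChar u) (kOfM T.D (ratChar u) u (natCast_ratChar_mem u) x₀))) + 1) *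
        ‖tqM T.D (ratChar u) u (natCast_ratChar_mem u) (ideleDataOf T.D T.isVolumeInputOf) x₀‖ ^ (((i : ℕ) + 1) ^ 2 - 1) < 1 := by
  exact GenuineM.exists_deep_triple_of_ten isABCTriple_frey6718464 T u (by rw [hu]; norm_num) (by rw [hu]; norm_num)
    (by rw [hu]; norm_num) (by rw [hu]; norm_num) 3 (by norm_num) (by rw [hu]; exact dvd_mul_of_dvd_left (dvd_mul_of_dvd_right (by norm_num) _) _)
    (by rw [hu]; norm_num) (by norm_num) 0 (by rw [hu]; norm_num) 5 (by norm_num) (by rw [hu]; norm_num)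

/-- **M-DEEP rows: R-W ANNEX-1 datum `2·3·11·13⁴ + 199³ = 5¹⁰` over `p = 199`, `l ∈ {17, 19}`** (`199³ ∥ abc`, `3 ∣ 3`, `B = 0`; top labels: `l = 17`:
`34·(9·198+197) = 67286 ≤ 6·7·9·197 = 74466`; `l = 19`: `38·(10·198+197) = 82726 ≤ 6·8·10·197 = 94560`). NOT `l = 11`: there `22·(6·198+197) = 30470 > 6·4·6·197 = 28368`
and every lower label fails too — the depth of that datum is left OPEN. [claim: Mochizuki2012, status: disputed] [cite: Mochizuki2012, IUTchIV Prop. 1.2 p. 10] -/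
theorem GenuineM.exists_deep_frey9765625_p199_tame {l : ℕ} (hl : l = 17 ∨ l = 19)
    (T : Cor22.ThetaVolumeDatumAt (ratPoint (((2 * 3 * 11 * 13 ^ 4 : ℕ) : ℚ) / (5 ^ 10 : ℕ))) l) (u : FinitePlace ℚ) (hu : ratChar u = 199) :
    letI := T.instFieldF; letI := T.instNumberFieldF; letI := T.instAlgebraF; letI := T.instFieldK
    letI := T.instNumberFieldK; letI := T.instAlgebraK; letI := T.instFieldFbar; letI := T.instAlgebraFbar
    letI := T.instAlgebraKFbar; letI := T.instIsElliptic
    ∃ (u : FinitePlace ℚ) (i : Fin (thetaIndexOfInitial T.D).lstar) (x₀ : (thetaIndexOfInitial T.D).Fibre (Val.non u)),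
        ((ratChar u : ℕ) : ℝ) ^ ((((i : ℕ) : ℝ) + 2) *
        (differentOrd (ratChar u) (kOfM T.D (ratChar u) u (natCast_ratChar_mem u) x₀)
        + logRadiusA (ratChar u) (absRamificationIdx (ratChar u) (kOfM T.D (ratChar u) u (natCast_ratChar_mem u) x₀))
        + logRadiusB (ratChar u) (absRamificationIdx (ratChar u) (kOfM T.D (ratChar u) u (natCast_ratChar_mem u) x₀))) + 1) *
        ‖tqM T.D (ratChar u) u (natCast_ratChar_mem u) (ideleDataOf T.D T.isVolumeInputOf) x₀‖ ^ (((i : ℕ) + 1) ^ 2 - 1) < 1 := by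
  exact GenuineM.exists_deep_triple_of_ten isABCTriple_frey9765625 T u (by rw [hu]; norm_num) (by rw [hu]; norm_num)
    (by rw [hu]; norm_num) (by rw [hu]; rcases hl with rfl | rfl <;> norm_num) 3 (by norm_num) (by rw [hu]; exact dvd_mul_of_dvd_left (dvd_mul_of_dvd_right (by norm_num) _) _)
    (by rw [hu]; norm_num) (by norm_num) 0 (by rw [hu]; rcases hl with rfl | rfl <;> norm_num) ((l - 3) / 2) (by rcases hl with rfl | rfl <;> norm_num) (by rw [hu]; rcases hl with rfl | rfl <;> norm_num)

/-- **M-DEEP rows: the 223-datum `2¹²·13³·223³ + 3¹⁵·11³·97⁵·409 = 5¹⁵·179⁴·2141` over `p = 97`, `l ∈ {7, 11, 13}`** (`97⁵ ∥ abc`, `5 ∣ 5`, `e ∣ 6·l`, `B = 0`: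
`6·l < 96`; top labels: `14·(4·96+95) = 6706 ≤ 10·2·4·95 = 7600` / `22·(6·96+95) = 14762 ≤ 22800` / `26·(7·96+95) = 19942 ≤ 33250`).
[claim: Mochizuki2012, status: disputed] [cite: Mochizuki2012, IUTchIV Prop. 1.2 p. 10] -/
theorem GenuineM.exists_deep_frey99794037551104_p97_tame {l : ℕ} (hl : l = 7 ∨ l = 11 ∨ l = 13)
    (T : Cor22.ThetaVolumeDatumAt (ratPoint (((2 ^ 12 * 13 ^ 3 * 223 ^ 3 : ℕ) : ℚ) / (5 ^ 15 * 179 ^ 4 * 2141 : ℕ))) l) (u : FinitePlace ℚ) (hu : ratChar u = 97) :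
    letI := T.instFieldF; letI := T.instNumberFieldF; letI := T.instAlgebraF; letI := T.instFieldK
    letI := T.instNumberFieldK; letI := T.instAlgebraK; letI := T.instFieldFbar; letI := T.instAlgebraFbar
    letI := T.instAlgebraKFbar; letI := T.instIsElliptic
    ∃ (u : FinitePlace ℚ) (i : Fin (thetaIndexOfInitial T.D).lstar) (x₀ : (thetaIndexOfInitial T.D).Fibre (Val.non u)),
        ((ratChar u : ℕ) : ℝ) ^ ((((i : ℕ) : ℝ) + 2) *
        (differentOrd (ratChar u) (kOfM T.D (ratChar u) u (natCast_ratChar_mem u) x₀)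
        + logRadiusA (ratChar u) (absRamificationIdx (ratChar u) (kOfM T.D (ratChar u) u (natCast_ratChar_mem u) x₀))
        + logRadiusB (ratChar u) (absRamificationIdx (ratChar u) (kOfM T.D (ratChar u) u (natCast_ratChar_mem u) x₀))) + 1) *
        ‖tqM T.D (ratChar u) u (natCast_ratChar_mem u) (ideleDataOf T.D T.isVolumeInputOf) x₀‖ ^ (((i : ℕ) + 1) ^ 2 - 1) < 1 := by
  exact GenuineM.exists_deep_triple_of_six isABCTriple_frey99794037551104 T u (by rw [hu]; norm_num) (by rw [hu]; norm_num)
    (by rw [hu]; norm_num) (by rw [hu]; rcases hl with rfl | rfl | rfl <;> norm_num) 5 (by norm_num) (by rw [hu]; exact dvd_mul_of_dvd_left (dvd_mul_of_dvd_right (by norm_num) _) _)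
    (by rw [hu]; norm_num) (by norm_num) 0 (by rw [hu]; rcases hl with rfl | rfl | rfl <;> norm_num) ((l - 3) / 2) (by rcases hl with rfl | rfl | rfl <;> norm_num) (by rw [hu]; rcases hl with rfl | rfl | rfl <;> norm_num)

/-- **M-DEEP rows: the 223-datum over `p = 223`, `l ∈ {13, 17, 19}`** (`223³ ∥ abc`, `3 ∣ 3`, `e ∣ 10·l`, `B = 0`: `10·l < 222`; top labels:
`26·(7·222+221) = 46150 ≤ 6·5·7·221 = 46410` / `34·(9·222+221) = 75446 ≤ 83538` / `38·(10·222+221) = 92758 ≤ 106080`). NOT `l = 11` over 223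
(`34166 > 31824`) — but that (datum, 11) is M-deep over 97 (previous theorem). [claim: Mochizuki2012, status: disputed] [cite: Mochizuki2012, IUTchIV Prop. 1.2 p. 10] -/
theorem GenuineM.exists_deep_frey99794037551104_p223_tame {l : ℕ} (hl : l = 13 ∨ l = 17 ∨ l = 19)
    (T : Cor22.ThetaVolumeDatumAt (ratPoint (((2 ^ 12 * 13 ^ 3 * 223 ^ 3 : ℕ) : ℚ) / (5 ^ 15 * 179 ^ 4 * 2141 : ℕ))) l) (u : FinitePlace ℚ) (hu : ratChar u = 223) :
    letI := T.instFieldF; letI := T.instNumberFieldF; letI := T.instAlgebraF; letI := T.instFieldK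
    letI := T.instNumberFieldK; letI := T.instAlgebraK; letI := T.instFieldFbar; letI := T.instAlgebraFbar
    letI := T.instAlgebraKFbar; letI := T.instIsElliptic
    ∃ (u : FinitePlace ℚ) (i : Fin (thetaIndexOfInitial T.D).lstar) (x₀ : (thetaIndexOfInitial T.D).Fibre (Val.non u)),
        ((ratChar u : ℕ) : ℝ) ^ ((((i : ℕ) : ℝ) + 2) *
        (differentOrd (ratChar u) (kOfM T.D (ratChar u) u (natCast_ratChar_mem u) x₀)
        + logRadiusA (ratChar u) (absRamificationIdx (ratChar u) (kOfM T.D (ratChar u) u (natCast_ratChar_mem u) x₀))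
        + logRadiusB (ratChar u) (absRamificationIdx (ratChar u) (kOfM T.D (ratChar u) u (natCast_ratChar_mem u) x₀))) + 1) *
        ‖tqM T.D (ratChar u) u (natCast_ratChar_mem u) (ideleDataOf T.D T.isVolumeInputOf) x₀‖ ^ (((i : ℕ) + 1) ^ 2 - 1) < 1 := by
  exact GenuineM.exists_deep_triple_of_ten isABCTriple_frey99794037551104 T u (by rw [hu]; norm_num) (by rw [hu]; norm_num)
    (by rw [hu]; norm_num) (by rw [hu]; rcases hl with rfl | rfl | rfl <;> norm_num) 3 (by norm_num) (by rw [hu]; exact dvd_mul_of_dvd_left (dvd_mul_of_dvd_left (by norm_num) _) _)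
    (by rw [hu]; norm_num) (by norm_num) 0 (by rw [hu]; rcases hl with rfl | rfl | rfl <;> norm_num) ((l - 3) / 2) (by rcases hl with rfl | rfl | rfl <;> norm_num) (by rw [hu]; rcases hl with rfl | rfl | rfl <;> norm_num)

/-- **M-DEEP rows: N3 triple `7⁵·61 + 2¹³·13⁷·17³·4229³ = 3¹³·5⁸·11³·53·73²·89²·103` over `p = 4229`, `l ∈ {53, 61, 73, 89, 103}`** (`v = 3`, `e ∣ 30·l`, `B = 0`:
`30·l < 4228`; abc-iut-C-cert-3's own `GenuineM.exists_deep_triple_of_linUniform` p472279 at the top label `i₀ = (l−3)/2`: e.g. `l = 89`: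
`178·(45·4228 + 4227) = 34618686 ≤ 6·43·45·4227 = 49075470`). [claim: Mochizuki2012, status: disputed] [cite: Mochizuki2012, IUTchIV Prop. 1.2 p. 10] -/
theorem GenuineM.exists_deep_frey1025227_p4229_tame {l : ℕ} (hl : l = 53 ∨ l = 61 ∨ l = 73 ∨ l = 89 ∨ l = 103)
    (T : Cor22.ThetaVolumeDatumAt (ratPoint (((7 ^ 5 * 61 : ℕ) : ℚ) / (3 ^ 13 * 5 ^ 8 * 11 ^ 3 * 53 * 73 ^ 2 * 89 ^ 2 * 103 : ℕ))) l) (u : FinitePlace ℚ) (hu : ratChar u = 4229) :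
    letI := T.instFieldF; letI := T.instNumberFieldF; letI := T.instAlgebraF; letI := T.instFieldK
    letI := T.instNumberFieldK; letI := T.instAlgebraK; letI := T.instFieldFbar; letI := T.instAlgebraFbar
    letI := T.instAlgebraKFbar; letI := T.instIsElliptic
    ∃ (u : FinitePlace ℚ) (i : Fin (thetaIndexOfInitial T.D).lstar) (x₀ : (thetaIndexOfInitial T.D).Fibre (Val.non u)),
        ((ratChar u : ℕ) : ℝ) ^ ((((i : ℕ) : ℝ) + 2) *
        (differentOrd (ratChar u) (kOfM T.D (ratChar u) u (natCast_ratChar_mem u) x₀)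
        + logRadiusA (ratChar u) (absRamificationIdx (ratChar u) (kOfM T.D (ratChar u) u (natCast_ratChar_mem u) x₀))
        + logRadiusB (ratChar u) (absRamificationIdx (ratChar u) (kOfM T.D (ratChar u) u (natCast_ratChar_mem u) x₀))) + 1) *
        ‖tqM T.D (ratChar u) u (natCast_ratChar_mem u) (ideleDataOf T.D T.isVolumeInputOf) x₀‖ ^ (((i : ℕ) + 1) ^ 2 - 1) < 1 := by
  exact GenuineM.exists_deep_triple_of_linUniform isABCTriple_4229 T u (by rw [hu]; norm_num) (by rw [hu]; norm_num)
    (by rw [hu]; norm_num) (by rw [hu]; rcases hl with rfl | rfl | rfl | rfl | rfl <;> norm_num) 0 (by rw [hu]; rcases hl with rfl | rfl | rfl | rfl | rfl <;> norm_num) 3 (by norm_num)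
    (by rw [hu]; exact dvd_mul_of_dvd_left (dvd_mul_of_dvd_right (by norm_num) _) _) ((l - 3) / 2) (by rcases hl with rfl | rfl | rfl | rfl | rfl <;> norm_num) (by rw [hu]; rcases hl with rfl | rfl | rfl | rfl | rfl <;> norm_num)

end Summit.ABC.IUTFork.Conditional

end
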